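import Summits.AtomisticToContinuum.FouriersLaw.Theses.CurrentTiltQuench
import Literature.MathematicalPhysics.KineticTheory.InfiniteChainObservables

/-!
# `CurrentTiltQuench.OddRigidityOfMacroErgodicity` (stmt-AtomisticToContinuum-11034) — proved

The catalogue hypothesis implies the odd-sector rigidity crux: `(∀ parameters > 0, IsMacroErgodic (pinnedChain …)) →`
`(every DLR Gibbs state of pinnedChain at every T' > 0 is momentum-reversal invariant) → BoundedOddRigidity`.

Proof: a shift-invariant, time-invariant, regular probability measure `ν` is, by macro-ergodicity, a Gibbs mixture `ν = ∫ μ_T π(dT)`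
(`Measure.bind`) with `μ_T` a DLR Gibbs state at `T > 0` for `π`-a.e. `T`; each such `μ_T` is reversal invariant by the second hypothesis,
so `ν ∘ R⁻¹ = π.bind (T ↦ μ_T ∘ R⁻¹) = π.bind (T ↦ μ_T) = ν` (`join_map_map`, `bind_congr_right`) — `ν` itself is reversal invariant;
and the clipped current `F_M(j_0) = max(-M, min(M, j_0))` is ODD under `R` (`j_0 ∘ R = -j_0`, the clip is odd), hence has zero `ν`-mean
(`integral_map_equiv`). No integrability or Bochner-over-bind bookkeeping is needed. Landed by lead c4 of crux stmt-9127: with the landed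
chain `NonBallistic ⟸ 9121 ∧ 11026 ∧ 11028 ∧ 11027` (p158806) it records kernel-side that stmt-9127 follows from (K), the two CTQ
response/compactness cruxes and the catalogued barrier `MacroErgodicityHypothesis` (+ reversal symmetry of the DLR states, in tree for the
shift-invariant one). No definitions.
-/

noncomputable section

namespace Summit.AtomisticToContinuum.FouriersLaw.Theorems.CurrentTiltQuench

open MeasureTheory Filter Topology
open Literature.MathematicalPhysics.KineticTheory.HeatConduction
open Summit.AtomisticToContinuum.FouriersLaw.Theses.CurrentTiltQuench

/-- The clip `u ↦ max (-M) (min M u)` is odd. [folklore] -/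
theorem clip_neg (M u : ℝ) (hM : 0 ≤ M) : max (-M) (min M (-u)) = -max (-M) (min M u) := by
  rcases le_total u M with h1 | h1
  · rcases le_total (-M) u with h2 | h2
    · rw [min_eq_right h1, max_eq_right h2, min_eq_right (by linarith), max_eq_right (by linarith)]
    · rw [min_eq_right h1, max_eq_left h2]
      rcases le_total M (-u) with h3 | h3
      · rw [min_eq_left h3, max_eq_right (by linarith)]
        linarith
      · rw [min_eq_right h3, max_eq_right (by linarith)]
        linarith
  · rw [min_eq_left h1, min_eq_right (show -u ≤ M by linarith), max_eq_left (show -u ≤ -M by linarith),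
      max_eq_right (show -M ≤ M by linarith)]

/-- **A Gibbs mixture of reversal-invariant states is reversal invariant.** If `ν = π.bind κ` with `κ` measurable and
`(κ T) ∘ R⁻¹ = κ T` for `π`-a.e. `T`, then `ν ∘ R⁻¹ = ν`. [folklore] -/
theorem map_momentumReversalZ_bind_eq {π : Measure ℝ} {κ : ℝ → Measure ChainConfig} (hκ : Measurable κ)
    (hR : ∀ᵐ T ∂π, (κ T).map momentumReversalZ = κ T) :
    (π.bind κ).map momentumReversalZ = π.bind κ := by
  have hκR : (fun T => (κ T).map momentumReversalZ) =ᵐ[π] κ := hR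
  calc (π.bind κ).map momentumReversalZ
      = π.bind (fun T => (κ T).map momentumReversalZ) := by
        simp only [Measure.bind]
        rw [← Measure.join_map_map momentumReversalZ.measurable,
          Measure.map_map (Measure.measurable_map _ momentumReversalZ.measurable) hκ]
        rfl
    _ = π.bind κ := Measure.bind_congr_right hκR

/-- **`OddRigidityOfMacroErgodicity` (stmt-AtomisticToContinuum-11034).** Macro-ergodicity of the infinite pinned chain (every
shift-invariant, time-invariant, regular probability measure is a Gibbs mixture) together with momentum-reversal invariance of every
DLR Gibbs state at positive temperature imply `BoundedOddRigidity`: every such measure gives zero mean to every clipped bond current.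
[cite: Bernardin2014, §1.1 Def. 1 and §1.2] -/
theorem oddRigidityOfMacroErgodicity_proof :
    Summit.AtomisticToContinuum.FouriersLaw.Theses.CurrentTiltQuench.OddRigidityOfMacroErgodicity := by
  intro hME hrevG ω₂ lam β γ hω hl hβ ν hprob hS hT hR M hM
  obtain ⟨π, κ, hπ, hκ, hae, hν⟩ := hME ω₂ lam β γ hω hl hβ ν hprob hS hT hR
  -- `ν` is reversal invariant
  have hκR : ∀ᵐ T ∂π, (κ T).map momentumReversalZ = κ T := by
    filter_upwards [hae] with T hT'
    exact hrevG ω₂ lam β γ hω hl hβ T hT'.1 (κ T) hT'.2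
  have hνR : ν.map momentumReversalZ = ν := by
    rw [hν]
    exact map_momentumReversalZ_bind_eq hκ hκR
  -- the clipped current is odd, hence has zero mean
  have h := integral_map_equiv momentumReversalZ
    (fun σ => max (-M) (min M ((pinnedChain ω₂ lam β γ).bondCurrentZ σ 0))) (μ := ν)
  rw [hνR] at h
  simp only [bondCurrentZ_momentumReversalZ] at h
  simp_rw [clip_neg M _ hM.le, integral_neg] at h
  linarith

end Summit.AtomisticToContinuum.FouriersLaw.Theorems.CurrentTiltQuench

end
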